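import Mathlib
import HarnessLib
import Literature.MathematicalPhysics.QuantumLattice.KohnLuttinger
import Literature.MathematicalPhysics.QuantumLattice.KohnLuttingerChannelStates
import Literature.MathematicalPhysics.QuantumLattice.KohnLuttingerPairingFormPolar
import Literature.MathematicalPhysics.QuantumLattice.KohnLuttingerLindhardMeasurable
import Summits.HubbardSuperconductivity.HubbardSuperconductivity.Theorems.WeakCouplingBCSWcbcsKohnLuttingerB1gReduction
import Summits.HubbardSuperconductivity.HubbardSuperconductivity.Theorems.WeakCouplingBCSWcbcsKohnLuttingerB1gKlCertForm
import Summits.HubbardSuperconductivity.HubbardSuperconductivity.Theorems.WeakCouplingBCSKlCertTPrimePHReflection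
import Summits.HubbardSuperconductivity.HubbardSuperconductivity.Theorems.ChiralWindowCwChannelInfContinuousL2
import Summits.HubbardSuperconductivity.HubbardSuperconductivity.Theorems.ChiralWindowCwKLChiralWindowD4Invariant
import Summits.HubbardSuperconductivity.HubbardSuperconductivity.Theorems.ChiralWindowCwThesisChannelInfNonpos
import Summits.HubbardSuperconductivity.HubbardSuperconductivity.Theorems.WeakCouplingBCSWcbcsKohnLuttingerB1gSublatticeDuality
import Summits.HubbardSuperconductivity.HubbardSuperconductivity.Theorems.WeakCouplingBCSKlSublatticeHolds
import Summits.HubbardSuperconductivity.HubbardSuperconductivity.Theorems.WeakCouplingBCSKlSublatticeFlip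

/-!
# Deck-even parts and flip transport in hypothesis form («(KLSCAN)-SUBLATTICE-DUALITY-DISCHARGE» part 11, toward S3;
# cell gate-hubbard-kl, seat p4 g20)

Hypothesis-form versions (any band `ε` whose Fermi-curve measure and kernel are deck-symmetric, finite and Hilbert–Schmidt) of the
deck machinery of parts 7–8, plus the transport of DECK-EVEN channel functions along the `(π, 0)`-flip `T₁` of part 10:

* §22 `klsl_integral_kernel_odd_of`, `klsl_pairingForm_even_odd_of`, **`klsl_exists_even_part`** (every channel state `f` has a
  deck-even-on-the-good-set channel function `e` with the same pairing form and `∫ e² ≤ 1`);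
* §23 **`klsl_flip_transport`**: if `T₁_* σ_b = σ_a` and `Γ_b(k,k') = Γ_a(T₁k, T₁k')` on the zone, a deck-even `L²(σ_a)` channel function
  pulls back to `𝟙_G · (g ∘ T₁)`: same channel, same norm, same form (the deck twist of `T₁` is absorbed by deck-evenness);
* §24 **`klsl_channelInf_le_of_evenTransport`**: even parts on side `a` + transport `a → b` + `channelInf_b ≤ 0` + bounded below
  ⇒ `channelInf_b ≤ channelInf_a` (normalise the transported even part; `N ≤ 1` and a negative form only help).

Honest framing: abstract bookkeeping; nothing asserts a margin, the window, `K₃` or superconductivity.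
-/

noncomputable section

set_option linter.dupNamespace false

namespace Summit.HubbardSuperconductivity.HubbardSuperconductivity.Theorems

open MeasureTheory Real Set Literature.MathematicalPhysics.QuantumLattice
open scoped ENNReal Pointwise

/-! ### §22 Deck-even parts, in hypothesis form (any band with a deck-symmetric Fermi-curve measure and kernel) -/

/-- **The kernel annihilates deck-odd functions** (hypothesis form): if `D_* σ = σ`, `Γ(k, D k') = Γ(k, k')` for `k' ∈ BZ` and
`g ∘ D = -g` a.e., then `∫ Γ(k, k') g(k') dσ(k') = 0` for every `k`. [folklore] -/
theorem klsl_integral_kernel_odd_of {ε : Momentum → ℝ} (hε : Measurable ε) (μ U : ℝ)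
    (hD : MeasurePreserving klphShift (fermiCurveMeasure ε μ) (fermiCurveMeasure ε μ))
    (hK : ∀ k, ∀ k' ∈ brillouinZone, kohnLuttingerKernel ε μ U k (klphShift k') = kohnLuttingerKernel ε μ U k k')
    (k : Momentum) {g : Momentum → ℝ} (hg : ∀ᵐ k' ∂fermiCurveMeasure ε μ, g (klphShift k') = -g k') :
    ∫ k', kohnLuttingerKernel ε μ U k k' * g k' ∂fermiCurveMeasure ε μ = 0 := by
  have h1 := hD.integral_comp klph_measurableEmbedding_shift (fun k' => kohnLuttingerKernel ε μ U k k' * g k')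
  have h2 : ∫ k', kohnLuttingerKernel ε μ U k (klphShift k') * g (klphShift k') ∂fermiCurveMeasure ε μ =
      ∫ k', -(kohnLuttingerKernel ε μ U k k' * g k') ∂fermiCurveMeasure ε μ := by
    refine integral_congr_ae ?_
    filter_upwards [hg, ae_mem_fermiCurve hε μ] with k' hk' hF
    rw [hK k k' hF.1, hk']
    ring
  rw [h2, integral_neg] at h1
  linarith

/-- **The pairing form drops the deck-odd part** (hypothesis form). [cite: RaghuKivelsonScalapino2010, §II (7)] -/
theorem klsl_pairingForm_even_odd_of {ε : Momentum → ℝ} (hε : Measurable ε) (μ U : ℝ)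
    [IsFiniteMeasure (fermiCurveMeasure ε μ)]
    (hHS : MemLp (fun z : Momentum × Momentum => lindhardFunction ε μ (z.1 + z.2)) 2
      ((fermiCurveMeasure ε μ).prod (fermiCurveMeasure ε μ)))
    (hD : MeasurePreserving klphShift (fermiCurveMeasure ε μ) (fermiCurveMeasure ε μ))
    (hK : ∀ k, ∀ k' ∈ brillouinZone, kohnLuttingerKernel ε μ U k (klphShift k') = kohnLuttingerKernel ε μ U k k')
    {f e o : Momentum → ℝ} (he : MemLp e 2 (fermiCurveMeasure ε μ)) (ho : MemLp o 2 (fermiCurveMeasure ε μ))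
    (hfe : ∀ k, f k = e k + o k) (hodd : ∀ᵐ k ∂fermiCurveMeasure ε μ, o (klphShift k) = -o k) :
    pairingForm ε μ U f = pairingForm ε μ U e := by
  have hK2 := klhs_frame_memLp_kernel U hHS
  have hf : MemLp f 2 (fermiCurveMeasure ε μ) := by
    have : f = fun k => e k + o k := funext hfe
    rw [this]; exact he.add ho
  have hPf := integral_mul_integral_mul_eq_integral_prod (M := fun z : Momentum × Momentum =>
    kohnLuttingerKernel ε μ U z.1 z.2) hf hK2
  have hPe := integral_mul_integral_mul_eq_integral_prod (M := fun z : Momentum × Momentum =>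
    kohnLuttingerKernel ε μ U z.1 z.2) he hK2
  unfold pairingForm
  rw [hPf, hPe]
  have iee : Integrable (fun z : Momentum × Momentum => kohnLuttingerKernel ε μ U z.1 z.2 * (e z.1 * e z.2))
      ((fermiCurveMeasure ε μ).prod (fermiCurveMeasure ε μ)) := hK2.integrable_mul (klsl_memLp_two_tensor he he)
  have ieo : Integrable (fun z : Momentum × Momentum => kohnLuttingerKernel ε μ U z.1 z.2 * (e z.1 * o z.2))
      ((fermiCurveMeasure ε μ).prod (fermiCurveMeasure ε μ)) := hK2.integrable_mul (klsl_memLp_two_tensor he ho)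
  have ioe : Integrable (fun z : Momentum × Momentum => kohnLuttingerKernel ε μ U z.1 z.2 * (o z.1 * e z.2))
      ((fermiCurveMeasure ε μ).prod (fermiCurveMeasure ε μ)) := hK2.integrable_mul (klsl_memLp_two_tensor ho he)
  have ioo : Integrable (fun z : Momentum × Momentum => kohnLuttingerKernel ε μ U z.1 z.2 * (o z.1 * o z.2))
      ((fermiCurveMeasure ε μ).prod (fermiCurveMeasure ε μ)) := hK2.integrable_mul (klsl_memLp_two_tensor ho ho)
  have hsplit : ∀ z : Momentum × Momentum,
      kohnLuttingerKernel ε μ U z.1 z.2 * (f z.1 * f z.2) =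
        (kohnLuttingerKernel ε μ U z.1 z.2 * (e z.1 * e z.2) + kohnLuttingerKernel ε μ U z.1 z.2 * (e z.1 * o z.2)) +
        (kohnLuttingerKernel ε μ U z.1 z.2 * (o z.1 * e z.2) + kohnLuttingerKernel ε μ U z.1 z.2 * (o z.1 * o z.2)) := by
    intro z; rw [hfe z.1, hfe z.2]; ring
  have i12 : Integrable (fun z : Momentum × Momentum =>
      kohnLuttingerKernel ε μ U z.1 z.2 * (e z.1 * e z.2) + kohnLuttingerKernel ε μ U z.1 z.2 * (e z.1 * o z.2))
      ((fermiCurveMeasure ε μ).prod (fermiCurveMeasure ε μ)) := iee.add ieo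
  have i34 : Integrable (fun z : Momentum × Momentum =>
      kohnLuttingerKernel ε μ U z.1 z.2 * (o z.1 * e z.2) + kohnLuttingerKernel ε μ U z.1 z.2 * (o z.1 * o z.2))
      ((fermiCurveMeasure ε μ).prod (fermiCurveMeasure ε μ)) := ioe.add ioo
  rw [integral_congr_ae (Filter.Eventually.of_forall hsplit), integral_add i12 i34, integral_add iee ieo, integral_add ioe ioo]
  have heo : ∫ z, kohnLuttingerKernel ε μ U z.1 z.2 * (e z.1 * o z.2) ∂(fermiCurveMeasure ε μ).prod (fermiCurveMeasure ε μ) = 0 := by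
    rw [← klsl_integral_bilinear_eq_prod (M := fun z : Momentum × Momentum => kohnLuttingerKernel ε μ U z.1 z.2) he ho hK2]
    simp only [klsl_integral_kernel_odd_of hε μ U hD hK _ hodd, mul_zero, integral_zero]
  have hoo : ∫ z, kohnLuttingerKernel ε μ U z.1 z.2 * (o z.1 * o z.2) ∂(fermiCurveMeasure ε μ).prod (fermiCurveMeasure ε μ) = 0 := by
    rw [← klsl_integral_bilinear_eq_prod (M := fun z : Momentum × Momentum => kohnLuttingerKernel ε μ U z.1 z.2) ho ho hK2]
    simp only [klsl_integral_kernel_odd_of hε μ U hD hK _ hodd, mul_zero, integral_zero]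
  have hoe : ∫ z, kohnLuttingerKernel ε μ U z.1 z.2 * (o z.1 * e z.2) ∂(fermiCurveMeasure ε μ).prod (fermiCurveMeasure ε μ) = 0 := by
    have hswap := integral_prod_swap (μ := fermiCurveMeasure ε μ) (ν := fermiCurveMeasure ε μ)
      (fun z : Momentum × Momentum => kohnLuttingerKernel ε μ U z.1 z.2 * (e z.1 * o z.2))
    have hcongr : ∫ z, kohnLuttingerKernel ε μ U z.1 z.2 * (o z.1 * e z.2) ∂(fermiCurveMeasure ε μ).prod (fermiCurveMeasure ε μ) =
        ∫ z, (fun w : Momentum × Momentum => kohnLuttingerKernel ε μ U w.1 w.2 * (e w.1 * o w.2)) z.swap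
          ∂(fermiCurveMeasure ε μ).prod (fermiCurveMeasure ε μ) := by
      refine integral_congr_ae (Filter.Eventually.of_forall fun z => ?_)
      simp only [Prod.fst_swap, Prod.snd_swap, kohnLuttingerKernel_comm ε μ U z.2 z.1]
      ring
    rw [hcongr, hswap, heo]
  rw [heo, hoe, hoo]
  ring

/-- **The deck-even part of a channel state** (hypothesis form): for a channel state `f` of a band whose Fermi-curve measure and
kernel are deck-symmetric and whose good set is full, `e := ½ f + ½ 𝟙_G (f ∘ D)` is in the same channel, is deck-even ON the good set
(pointwise), has the same pairing form as `f`, and has square norm `≤ 1`. [cite: RaghuKivelsonScalapino2010, §II (7) and §III (17)] -/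
theorem klsl_exists_even_part {ε : Momentum → ℝ} (hε : Measurable ε) {μ : ℝ} (U : ℝ)
    [IsFiniteMeasure (fermiCurveMeasure ε μ)]
    (hHS : MemLp (fun z : Momentum × Momentum => lindhardFunction ε μ (z.1 + z.2)) 2
      ((fermiCurveMeasure ε μ).prod (fermiCurveMeasure ε μ)))
    (hD : MeasurePreserving klphShift (fermiCurveMeasure ε μ) (fermiCurveMeasure ε μ))
    (hK : ∀ k, ∀ k' ∈ brillouinZone, kohnLuttingerKernel ε μ U k (klphShift k') = kohnLuttingerKernel ε μ U k k')
    (hG : ∀ᵐ k ∂fermiCurveMeasure ε μ, k ∈ klphGood) {χ : D4Irrep} {f : Momentum → ℝ} (hf : IsChannelState ε μ χ f) :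
    ∃ e : Momentum → ℝ, MemLp e 2 (fermiCurveMeasure ε μ) ∧ InChannel χ e ∧ (∀ k ∈ klphGood, e (klphShift k) = e k) ∧
      pairingForm ε μ U f = pairingForm ε μ U e ∧ ∫ k, e k ^ 2 ∂fermiCurveMeasure ε μ ≤ 1 := by
  obtain ⟨hmem, hnorm, hch⟩ := hf
  have haeD : klphGood.indicator (f ∘ klphShift) =ᵐ[fermiCurveMeasure ε μ] (f ∘ klphShift) := by
    filter_upwards [hG] with k hk; simp only [Set.indicator_of_mem hk]
  have hmemD : MemLp (klphGood.indicator (f ∘ klphShift)) 2 (fermiCurveMeasure ε μ) :=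
    (hmem.comp_measurePreserving hD).ae_eq haeD.symm
  have hchD : InChannel χ (klphGood.indicator (f ∘ klphShift)) := klsl_inChannel_shift hch
  refine ⟨fun k => 2⁻¹ * f k + 2⁻¹ * klphGood.indicator (f ∘ klphShift) k, (hmem.const_mul _).add (hmemD.const_mul _),
    kl_hc_inChannel_linear _ _ _ _ _ hch hchD, fun k hk => ?_, ?_, ?_⟩
  · have hk' := klsl_klphShift_mem_klphGood hk
    simp only [Set.indicator_of_mem hk, Set.indicator_of_mem hk', Function.comp_apply, klphShift_klphShift]
    ring
  · have he' : MemLp (fun k => 2⁻¹ * f k + 2⁻¹ * klphGood.indicator (f ∘ klphShift) k) 2 (fermiCurveMeasure ε μ) :=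
      (hmem.const_mul _).add (hmemD.const_mul _)
    have ho' : MemLp (fun k => 2⁻¹ * f k + (-2⁻¹) * klphGood.indicator (f ∘ klphShift) k) 2 (fermiCurveMeasure ε μ) :=
      (hmem.const_mul _).add (hmemD.const_mul _)
    refine klsl_pairingForm_even_odd_of hε μ U hHS hD hK he' ho' (fun k => by ring) ?_
    filter_upwards [hG] with k hk
    have hk' := klsl_klphShift_mem_klphGood hk
    simp only [Set.indicator_of_mem hk, Set.indicator_of_mem hk', Function.comp_apply, klphShift_klphShift]
    ring
  · have hnormD : ∫ k, klphGood.indicator (f ∘ klphShift) k ^ 2 ∂fermiCurveMeasure ε μ = 1 := by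
      have h1 : ∫ k, klphGood.indicator (f ∘ klphShift) k ^ 2 ∂fermiCurveMeasure ε μ =
          ∫ k, (fun u => f u ^ 2) (klphShift k) ∂fermiCurveMeasure ε μ :=
        integral_congr_ae (haeD.mono fun k hk => by simp only [hk, Function.comp_apply])
      rw [h1, hD.integral_comp klph_measurableEmbedding_shift (fun u => f u ^ 2)]
      exact hnorm
    have hsq1 : Integrable (fun k => f k ^ 2) (fermiCurveMeasure ε μ) := (memLp_two_iff_integrable_sq hmem.1).1 hmem
    have hsq2 : Integrable (fun k => klphGood.indicator (f ∘ klphShift) k ^ 2) (fermiCurveMeasure ε μ) :=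
      (memLp_two_iff_integrable_sq hmemD.1).1 hmemD
    have hle : ∀ k, (2⁻¹ * f k + 2⁻¹ * klphGood.indicator (f ∘ klphShift) k) ^ 2 ≤
        2⁻¹ * f k ^ 2 + 2⁻¹ * klphGood.indicator (f ∘ klphShift) k ^ 2 := by
      intro k; nlinarith [sq_nonneg (f k - klphGood.indicator (f ∘ klphShift) k)]
    have hi1 : Integrable (fun k => 2⁻¹ * f k ^ 2) (fermiCurveMeasure ε μ) := hsq1.const_mul 2⁻¹
    have hi2 : Integrable (fun k => 2⁻¹ * klphGood.indicator (f ∘ klphShift) k ^ 2) (fermiCurveMeasure ε μ) := hsq2.const_mul 2⁻¹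
    have hi12 : Integrable (fun k => 2⁻¹ * f k ^ 2 + 2⁻¹ * klphGood.indicator (f ∘ klphShift) k ^ 2) (fermiCurveMeasure ε μ) :=
      hi1.add hi2
    have hnn : (0 : Momentum → ℝ) ≤ᵐ[fermiCurveMeasure ε μ] fun k => (2⁻¹ * f k + 2⁻¹ * klphGood.indicator (f ∘ klphShift) k) ^ 2 :=
      Filter.Eventually.of_forall fun k => sq_nonneg _
    have hmono := integral_mono_of_nonneg hnn hi12 (Filter.Eventually.of_forall hle)
    rw [integral_add hi1 hi2, integral_const_mul, integral_const_mul, hnorm, hnormD] at hmono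
    linarith

/-! ### §23 Transport of deck-even channel functions along the flip, in hypothesis form -/

/-- **Flip transport** (hypothesis form): if `T₁_* σ_b = σ_a`, the good set is `σ_b`-full and `Γ_b(k, k') = Γ_a(T₁ k, T₁ k')` on the
zone, then a deck-even `L²(σ_a)` channel function `g` pulls back to `𝟙_G · (g ∘ T₁)`: same channel, still deck-even on the good set,
same square norm and same pairing form. [cite: RaghuKivelsonScalapino2010, §II (7) and §III (17)] -/
theorem klsl_flip_transport {εa εb : Momentum → ℝ} (hεb : Measurable εb) {μ : ℝ} (U : ℝ)
    (hT : MeasurePreserving klslFlip (fermiCurveMeasure εb μ) (fermiCurveMeasure εa μ))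
    (hKT : ∀ k ∈ brillouinZone, ∀ k' ∈ brillouinZone,
      kohnLuttingerKernel εb μ U k k' = kohnLuttingerKernel εa μ U (klslFlip k) (klslFlip k'))
    (hGb : ∀ᵐ k ∂fermiCurveMeasure εb μ, k ∈ klphGood) {χ : D4Irrep} {g : Momentum → ℝ}
    (hmem : MemLp g 2 (fermiCurveMeasure εa μ)) (hch : InChannel χ g) (heven : ∀ k ∈ klphGood, g (klphShift k) = g k) :
    MemLp (klphGood.indicator (g ∘ klslFlip)) 2 (fermiCurveMeasure εb μ) ∧
      InChannel χ (klphGood.indicator (g ∘ klslFlip)) ∧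
      (∀ k ∈ klphGood, klphGood.indicator (g ∘ klslFlip) (klphShift k) = klphGood.indicator (g ∘ klslFlip) k) ∧
      ∫ k, klphGood.indicator (g ∘ klslFlip) k ^ 2 ∂fermiCurveMeasure εb μ = ∫ u, g u ^ 2 ∂fermiCurveMeasure εa μ ∧
      pairingForm εb μ U (klphGood.indicator (g ∘ klslFlip)) = pairingForm εa μ U g := by
  have hae : klphGood.indicator (g ∘ klslFlip) =ᵐ[fermiCurveMeasure εb μ] (g ∘ klslFlip) := by
    filter_upwards [hGb] with k hk; simp only [Set.indicator_of_mem hk]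
  have hBZ : ∀ᵐ k ∂fermiCurveMeasure εb μ, k ∈ brillouinZone := (ae_mem_fermiCurve hεb μ).mono fun k hk => hk.1
  refine ⟨(hmem.comp_measurePreserving hT).ae_eq hae.symm, klsl_inChannel_flip hch heven, fun k hk => ?_, ?_, ?_⟩
  · have hk' := klsl_klslFlip_mem_klphGood hk
    have hDk := klsl_klphShift_mem_klphGood hk
    simp only [Set.indicator_of_mem hk, Set.indicator_of_mem hDk, Function.comp_apply]
    -- `T₁ (D k) = D (T₁ k)` exactly
    have hcomm : klslFlip (klphShift k) = klphShift (klslFlip k) := by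
      ext i; fin_cases i <;> simp [klphTau_klphTau]
    rw [hcomm, heven _ hk']
  · have h1 : ∫ k, klphGood.indicator (g ∘ klslFlip) k ^ 2 ∂fermiCurveMeasure εb μ =
        ∫ k, (fun u => g u ^ 2) (klslFlip k) ∂fermiCurveMeasure εb μ :=
      integral_congr_ae (hae.mono fun k hk => by simp only [hk, Function.comp_apply])
    rw [h1, hT.integral_comp klsl_measurableEmbedding_flip (fun u => g u ^ 2)]
  · rw [klsl_pairingForm_congr_ae U hae]
    unfold pairingForm
    have hinner : ∀ k ∈ brillouinZone, ∫ k', kohnLuttingerKernel εb μ U k k' * g (klslFlip k') ∂fermiCurveMeasure εb μ =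
        ∫ u, kohnLuttingerKernel εa μ U (klslFlip k) u * g u ∂fermiCurveMeasure εa μ := by
      intro k hk
      have h1 : ∫ k', kohnLuttingerKernel εb μ U k k' * g (klslFlip k') ∂fermiCurveMeasure εb μ =
          ∫ k', (fun u => kohnLuttingerKernel εa μ U (klslFlip k) u * g u) (klslFlip k') ∂fermiCurveMeasure εb μ := by
        refine integral_congr_ae ?_
        filter_upwards [hBZ] with k' hk'
        simp only [hKT k hk k' hk']
      rw [h1, hT.integral_comp klsl_measurableEmbedding_flip (fun u => kohnLuttingerKernel εa μ U (klslFlip k) u * g u)]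
    have h2 : ∫ k, (g ∘ klslFlip) k * ∫ k', kohnLuttingerKernel εb μ U k k' * (g ∘ klslFlip) k' ∂fermiCurveMeasure εb μ
          ∂fermiCurveMeasure εb μ =
        ∫ k, (fun u => g u * ∫ u', kohnLuttingerKernel εa μ U u u' * g u' ∂fermiCurveMeasure εa μ) (klslFlip k)
          ∂fermiCurveMeasure εb μ := by
      refine integral_congr_ae ?_
      filter_upwards [hBZ] with k hk
      simp only [Function.comp_apply]
      rw [hinner k hk]
    rw [h2, hT.integral_comp klsl_measurableEmbedding_flip
      (fun u => g u * ∫ u', kohnLuttingerKernel εa μ U u u' * g u' ∂fermiCurveMeasure εa μ)]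

/-! ### §24 One direction of S3, in hypothesis form -/

/-- **Even parts + flip transport + non-positivity ⇒ one inequality of channel bottoms** (hypothesis form): if every `χ`-state of
band `a` has a deck-even part with the same form and norm `≤ 1`, deck-even `χ`-functions of `a` transport to `b` with the same norm and
form, the `b`-value set is bounded below and `channelInf_b ≤ 0`, then `channelInf_b ≤ channelInf_a`. [cite: RaghuKivelsonScalapino2010, §II (13)] -/
theorem klsl_channelInf_le_of_evenTransport {εa εb : Momentum → ℝ} {μ : ℝ} (U : ℝ) (χ : D4Irrep)
    (hEven : ∀ f, IsChannelState εa μ χ f → ∃ e : Momentum → ℝ, MemLp e 2 (fermiCurveMeasure εa μ) ∧ InChannel χ e ∧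
      (∀ k ∈ klphGood, e (klphShift k) = e k) ∧ pairingForm εa μ U f = pairingForm εa μ U e ∧
      ∫ k, e k ^ 2 ∂fermiCurveMeasure εa μ ≤ 1)
    (hTrans : ∀ e : Momentum → ℝ, MemLp e 2 (fermiCurveMeasure εa μ) → InChannel χ e →
      (∀ k ∈ klphGood, e (klphShift k) = e k) → ∃ g : Momentum → ℝ, MemLp g 2 (fermiCurveMeasure εb μ) ∧ InChannel χ g ∧
        ∫ k, g k ^ 2 ∂fermiCurveMeasure εb μ = ∫ k, e k ^ 2 ∂fermiCurveMeasure εa μ ∧ pairingForm εb μ U g = pairingForm εa μ U e)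
    (hbdd : BddBelow ((pairingForm εb μ U) '' {ψ | IsChannelState εb μ χ ψ})) (hnonpos : channelInf εb μ U χ ≤ 0) :
    channelInf εb μ U χ ≤ channelInf εa μ U χ := by
  rw [channelInf, channelInf] at *
  by_cases hne : ((pairingForm εa μ U) '' {ψ | IsChannelState εa μ χ ψ}).Nonempty
  swap
  · rw [Set.not_nonempty_iff_eq_empty.1 hne, Real.sInf_empty]; exact hnonpos
  refine le_csInf hne ?_
  rintro v ⟨f, hf, rfl⟩
  rcases le_or_gt 0 (pairingForm εa μ U f) with hv | hv
  · exact hnonpos.trans hv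
  obtain ⟨e, hemem, hech, heven, hform, hN1⟩ := hEven f hf
  obtain ⟨g, hgmem, hgch, hgnorm, hgform⟩ := hTrans e hemem hech heven
  obtain ⟨N, hN⟩ : ∃ N : ℝ, ∫ k, e k ^ 2 ∂fermiCurveMeasure εa μ = N := ⟨_, rfl⟩
  rw [hN] at hN1 hgnorm
  have hN0 : 0 ≤ N := hN ▸ integral_nonneg fun k => sq_nonneg _
  -- `N > 0`, for otherwise `e = 0` a.e. and the form of `f` would vanish
  have hNpos : 0 < N := by
    rcases hN0.eq_or_lt with hNz | hNpos
    · exfalso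
      have hint0 : ∫ k, e k ^ 2 ∂fermiCurveMeasure εa μ = 0 := by rw [hN, ← hNz]
      have h0 := (integral_eq_zero_iff_of_nonneg (fun k => sq_nonneg (e k)) ((memLp_two_iff_integrable_sq hemem.1).1 hemem)).1 hint0
      have he0 : e =ᵐ[fermiCurveMeasure εa μ] 0 := by filter_upwards [h0] with k hk; simpa using hk
      have : pairingForm εa μ U f = 0 := by
        rw [hform, klsl_pairingForm_congr_ae U he0]
        simp only [pairingForm, Pi.zero_apply, mul_zero, integral_zero]
      linarith
    · exact hNpos
  -- normalise the transported function
  have hsN : 0 < Real.sqrt N := Real.sqrt_pos.2 hNpos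
  have hc2 : (Real.sqrt N)⁻¹ ^ 2 * N = 1 := by rw [inv_pow, Real.sq_sqrt hNpos.le, inv_mul_cancel₀ hNpos.ne']
  have hstate : IsChannelState εb μ χ (fun k => (Real.sqrt N)⁻¹ * g k) := by
    refine ⟨hgmem.const_mul _, ?_, ?_⟩
    · simp only [mul_pow]; rw [integral_const_mul, hgnorm, hc2]
    · have h := kl_hc_inChannel_linear χ g g (Real.sqrt N)⁻¹ 0 hgch hgch
      simpa using h
  have hval : pairingForm εb μ U (fun k => (Real.sqrt N)⁻¹ * g k) = (Real.sqrt N)⁻¹ ^ 2 * pairingForm εa μ U f := by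
    rw [hform, ← hgform]
    simp only [pairingForm]
    exact klb1g_form_smul _ _ _ _
  have hle := csInf_le hbdd ⟨_, hstate, rfl⟩
  rw [hval, inv_pow, Real.sq_sqrt hNpos.le] at hle
  -- `N⁻¹ · form ≤ form` since `form < 0` and `N ≤ 1`
  have hkey : N⁻¹ * pairingForm εa μ U f ≤ pairingForm εa μ U f := by
    have h1 : 1 ≤ N⁻¹ := one_le_inv_iff₀.2 ⟨hNpos, hN1⟩
    nlinarith
  exact hle.trans hkey

end Summit.HubbardSuperconductivity.HubbardSuperconductivity.Theorems

end
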